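import Mathlib

/-!
# Solo-blind seat, s19 anchor (b): the transversality recursion for two-subgroup TPP towers
(Theorem 15 of `paper/LieExponent.md` §3.29) — arithmetic core

Setting (pen side, §3.28–3.29): a TPP triple `(M₁; H₂, H₃)` of a real Lie group with two connected
Lie-subgroup members, `Σ > d`, pair codimension `m`, index `ι`, deficit `δ = 3d/2 − Σ`; along the
characteristic tower (levels `ℓ = 0, …, t − 1`) let

* `s ℓ` = the transversal dimension `dim (V₁^{(ℓ)} + U^{(ℓ)}) / U^{(ℓ)}` of the curved member
  relative to the subgroup pair `U^{(ℓ)} = 𝔨₂^{(ℓ)} ⊕ 𝔨₃^{(ℓ)}` (`s 0 ≤ m − 1`),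
* `R ℓ` = the motion of the annihilator at level `ℓ` (`R ℓ ≤ s ℓ`: the annihilator section can be
  chosen inside a fixed generic `(s+1)`-plane of the pencil),
* `i ℓ` = the LAGRANGIAN INTERSECTION INDEX `dim (K̄₂^{(ℓ)} ∩ K̄₃^{(ℓ)})` of the images of the two
  subgroup algebras in the symplectic quotient `ker λ_ℓ / rad(ω_{λ_ℓ}|ker λ_ℓ)`.

The geometric input of Theorem 15 is the pointwise recursion `s (ℓ+1) ≤ s ℓ − R ℓ + i ℓ`
(torsion identity: every motion covector at level `ℓ` is a pinning covector at level `ℓ+1`);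
in its ADAPTED form (reference spaces `W_ℓ = U ∩ 𝔞_ℓ` instead of the level-`ℓ` pair, annihilators
chosen to kill `W_ℓ`, possible at every level where `V₁^{(ℓ)} + W_ℓ ≠ 𝔞_ℓ`) the phantom term
disappears: `s (ℓ+1) ≤ s ℓ − R ℓ`, i.e. the case `i ≡ 0` below.
This file kernel-checks the bookkeeping that turns it into

* `soloLie_transversality_slack`     : `s n ≤ s 0 − Σ_{ℓ<n} R ℓ + Σ_{ℓ<n} i ℓ`;
* `soloLie_transversality_telescope` : `Σ_{ℓ≤n} R ℓ ≤ s 0 + Σ_{ℓ<n} i ℓ` (linear total motion up to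
  the intersection indices);
* `soloLie_transversality_deficit`   : with (MD) `δ + ΣR ≥ (ι+t+1)/2`, `ΣR ≤ s₀ + I`, `s₀ ≤ m − 1`
  and the pair bound `δ ≥ m/2 + 1`: `δ ≥ (ι + 7 − 2I)/6` — a LINEAR deficit for symplectically
  transversal towers (`I = 0`), i.e. weak (K∞) for that class;
* `soloLie_transversality_GL`        : `GL_n(ℝ)` form `Σ ≤ 3n²/2 − (n + 7 − 2I)/6`;
* `soloLie_transversality_floor`     : with `I = 0` the exponent `6n/(3n − 2δ)` certified through the
  Cor 2.8 dictionary is `> 9/4` for every `n`.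

All statements are arithmetic with the geometric facts as hypotheses, in the style of the seat's
earlier anchors (SoloBlindDescent, SoloBlindTwoSubgroupDeficit).
-/

set_option linter.dupNamespace false

namespace Summit.MatrixMultiplication.MatrixMultiplication.Theorems

open Finset

/-- Slack propagation: from `s (ℓ+1) ≤ s ℓ - R ℓ + i ℓ` for all `ℓ < n`,
`s n ≤ s 0 - Σ_{ℓ<n} R ℓ + Σ_{ℓ<n} i ℓ`. -/
theorem soloLie_transversality_slack (s R i : ℕ → ℝ) :
    ∀ n : ℕ, (∀ ℓ, ℓ < n → s (ℓ + 1) ≤ s ℓ - R ℓ + i ℓ) →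
      s n ≤ s 0 - (∑ ℓ ∈ range n, R ℓ) + ∑ ℓ ∈ range n, i ℓ := by
  intro n
  induction n with
  | zero => intro _; simp
  | succ k ih =>
    intro hrec
    have hk : s (k + 1) ≤ s k - R k + i k := hrec k (Nat.lt_succ_self k)
    have ih' := ih (fun ℓ hℓ => hrec ℓ (Nat.lt_succ_of_lt hℓ))
    rw [sum_range_succ, sum_range_succ]
    linarith

/-- THEOREM 15 (bookkeeping): linear total motion up to the Lagrangian intersection indices.
If `s (ℓ+1) ≤ s ℓ - R ℓ + i ℓ` for `ℓ < n` and `R n ≤ s n`, then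
`Σ_{ℓ ≤ n} R ℓ ≤ s 0 + Σ_{ℓ < n} i ℓ`. -/
theorem soloLie_transversality_telescope (s R i : ℕ → ℝ) (n : ℕ)
    (hrec : ∀ ℓ, ℓ < n → s (ℓ + 1) ≤ s ℓ - R ℓ + i ℓ) (hRs : R n ≤ s n) :
    (∑ ℓ ∈ range (n + 1), R ℓ) ≤ s 0 + ∑ ℓ ∈ range n, i ℓ := by
  have h1 := soloLie_transversality_slack s R i n hrec
  rw [sum_range_succ]
  linarith

/-- Nonnegative motions: every partial sum is bounded the same way (the tower may be cut anywhere). -/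
theorem soloLie_transversality_telescope' (s R i : ℕ → ℝ) (n : ℕ)
    (hrec : ∀ ℓ, ℓ < n → s (ℓ + 1) ≤ s ℓ - R ℓ + i ℓ) (hRs : ∀ ℓ, ℓ ≤ n → R ℓ ≤ s ℓ)
    (hi : ∀ ℓ, 0 ≤ i ℓ) (k : ℕ) (hk : k ≤ n) :
    (∑ ℓ ∈ range (k + 1), R ℓ) ≤ s 0 + ∑ ℓ ∈ range n, i ℓ := by
  have h := soloLie_transversality_telescope s R i k
    (fun ℓ hℓ => hrec ℓ (lt_of_lt_of_le hℓ hk)) (hRs k hk)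
  have hmono : (∑ ℓ ∈ range k, i ℓ) ≤ ∑ ℓ ∈ range n, i ℓ :=
    sum_le_sum_of_subset_of_nonneg (range_mono hk) (fun ℓ _ _ => hi ℓ)
  linarith

/-- COROLLARY 15.1 (deficit form). (MD) `δ + ΣR ≥ (ι+t+1)/2`, `t ≥ 0`, total motion
`ΣR ≤ s₀ + I`, `s₀ ≤ m - 1`, and the pair bound `δ ≥ m/2 + 1` give the LINEAR bound
`δ ≥ (ι + 7 - 2I)/6`. -/
theorem soloLie_transversality_deficit (ι δ m I t SR s₀ : ℝ)
    (hMD : (ι + t + 1) / 2 ≤ δ + SR) (ht : 0 ≤ t) (hS : SR ≤ s₀ + I) (hs : s₀ ≤ m - 1)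
    (hpair : m / 2 + 1 ≤ δ) :
    (ι + 7 - 2 * I) / 6 ≤ δ := by
  linarith

/-- The symplectically transversal case `I = 0`: `δ ≥ (ι + 7)/6`. -/
theorem soloLie_transversality_deficit_transversal (ι δ m t SR s₀ : ℝ)
    (hMD : (ι + t + 1) / 2 ≤ δ + SR) (ht : 0 ≤ t) (hS : SR ≤ s₀) (hs : s₀ ≤ m - 1)
    (hpair : m / 2 + 1 ≤ δ) :
    (ι + 7) / 6 ≤ δ := by
  have := soloLie_transversality_deficit ι δ m 0 t SR s₀ hMD ht (by simpa using hS) hs hpair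
  linarith

/-- `GL_n(ℝ)` form (`ι = n`, `d = n²`): `Σ ≤ 3n²/2 - (n + 7 - 2I)/6`. -/
theorem soloLie_transversality_GL (n Sig δ I : ℝ) (hδ : δ = 3 * n ^ 2 / 2 - Sig)
    (h : (n + 7 - 2 * I) / 6 ≤ δ) :
    Sig ≤ 3 * n ^ 2 / 2 - (n + 7 - 2 * I) / 6 := by
  linarith

/-- Certification floor for symplectically transversal two-subgroup inputs of `GL_n(ℝ)`:
through the Cor 2.8 dictionary (density 1) an input of deficit `δ` certifies exactly
`ω ≤ 6n/(3n - 2δ)`; with `δ ≥ (n+7)/6` this number is `> 9/4` for every `n`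
(such inputs never certify an exponent below `9/4`, let alone `2`). -/
theorem soloLie_transversality_floor (n δ : ℝ) (h : (n + 7) / 6 ≤ δ)
    (hlt : 2 * δ < 3 * n) :
    (9 : ℝ) / 4 < 6 * n / (3 * n - 2 * δ) := by
  have hpos : 0 < 3 * n - 2 * δ := by linarith
  rw [lt_div_iff₀ hpos]
  linarith

end Summit.MatrixMultiplication.MatrixMultiplication.Theorems
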